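import Summits.Ventures.AbcSig.Rows.StatementsC1b
import Summits.Ventures.AbcSig.Rows.Xn64Yn17Z2XE

/-!
# Venture AbcSig — CELL bridge for `xⁿ + 2^α yⁿ = 17 z²` (FAMILY C1b, `α = 6`): p1's census predicate `Rows.C1bCell 17 (fun _ α => α = 6) 7 ∅`

E-VARIANT (p-lean g6 `gen6/e3patch.py`) of `C1bCell_17_a6_of`: ERRATA E3 form — level 578 removed, hypothesis `hE3 : M.E3Package` added (see `Rows/Xn64Yn17Z2XE.lean`).
HONEST FRAMING. COMPUTATION cell `pub-abcsig`; CONDITIONAL theorem; no claim on ABC or any summit. Hypotheses exactly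
those of `Rows/Xn64Yn17Z2X.lean` (`xrow_Xn64Yn17Z2`): `BS04Package` (CITED), `DataComplete` at the two levels (COMPUTED, certified level
files) and the row's per-orbit CITED exclusions `hX_…`, universally quantified in the exponent. Conclusion = the conjunct
`Rows.C1bCell 17 (fun _ α => α = 6) 7 ∅` of p1's `Rows.C1bSmallAlphaSigned` / `Rows.C1bExtSigned`
(`Rows/StatementsC1b.lean`; row of record `census/rows/C1b/C1b-C17-a6.md`, R8-signed): every prime `n ≥ 7`, `n ∤ 17`,
`α = 6`, no primitive solution with `|xy| > 1`. GENERATED by p-lean gen3/make_c1bcell.py (pattern of `Rows/Xn8Yn11Z2Cell.lean`).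
-/

namespace Summit.Ventures.AbcSig

/-- `xⁿ + 2^α yⁿ = 17z²` (`α = 6`), every prime `n ≥ 7` with `n ∤ 17`, `|xy| > 1`: p1's conjunct
`Rows.C1bCell 17 (fun _ α => α = 6) 7 ∅` from `xrow_Xn64Yn17Z2`. -/
theorem C1bCell_17_a6E_of (M : NewformModel) (hP : M.BS04Package) (hE3 : M.E3Package)
    (hD289 : M.DataComplete 289 level289Orbits)
    (hX_orbit_289_1 : ∀ n : ℕ, M.Excludes 289 orbit_289_1 (famBC 6 17 n (fun _ b => ¬ 2 ∣ b)))
    (hX_orbit_289_1e : ∀ n : ℕ, M.Excludes 289 orbit_289_1 (famBC 6 17 n (fun _ b => 2 ∣ b))) :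
    Rows.C1bCell 17 (fun _ α => α = 6) 7 ∅ := by
  intro n hn h0 hC _ α hα x y z h1 h2
  subst hα
  exact xrow_Xn64Yn17Z2XE M hP hE3 hD289 n hn h0 (by
      intro hmem
      simp only [List.mem_cons, List.not_mem_nil, or_false] at hmem
      subst hmem
      exact hC (by norm_num)) (hX_orbit_289_1 n) (hX_orbit_289_1e n) x y z h1 h2

end Summit.Ventures.AbcSig
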